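import Summits.Ventures.LatticeQCDFlow.Scaling.MeanActionTransportSteps
import Summits.Ventures.LatticeQCDFlow.Scaling.EntropicTransport

/-!
# LatticeQCDFlow / Scaling — TRANSPORT LAWS WITHOUT EXACTNESS (C2a-CΔ): every co-Lipschitz flow pays `(d-1)/(2d)·log β` per unit volume in `log coLip` OR in mean action

HONEST FRAMING: exact (Metropolis-corrected) sampling algorithms for lattice gauge theory; figures of merit are
autocorrelation/cost numbers at stated couplings and volumes; no continuum-physics claim.

Venture `LatticeQCDFlow` (cell pub-lqcd), topic `Scaling`, FANOUT row 29 (theory-2) — OUR WORK (THEORY-2.md §3.3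
v2.9).  The entropic cooling laws of `Scaling/EntropicTransport.lean` (items 57–58: `CoolingContractionBetween`,
`ExactTransportContractionSharp`) bound the co-Lipschitz constant of an EXACT transport `T_*μ_{Λ,β₀} = μ_{Λ,β}`
from below by `(β/β₀)^{(d-1)/(2d)}` uniformly in the volume; the only inexact law in the tree,
`AccurateTransportContraction` (item 46, total-variation accuracy `ε ≤ 1/4`), keeps the packing exponent `1/(16d)`
because TV-accuracy loses the pointwise density step (THEORY-2.md §0⁰, recorded as NOT available by that
technique).  This file states and proves the SHARP laws for ARBITRARY measurable co-Lipschitz maps — no accuracy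
hypothesis of any kind — in the currency in which they survive: the MEAN ACTION of the model.  With
`c_lo(L) = (d-1)L^d(1/2-1/L) - 1/2`, `c_up(L) = ((d-1)L^d+1)/2` and `Δ_T = ∫ S∘T dμ_{Λ,β₀} - ⟨S⟩_{Λ,β}`
(how much hotter, in mean Wilson action, the model `T_*μ_{Λ,β₀}` is than its target),

* `MeanActionContractionBetween d N G ρ κ` (C2a-CΔ): `∃ C, ∀ L ≥ 2, ∀ 1 ≤ β₀ ≤ β, ∀ T` `K'`-co-Lipschitz and
  `μ_{Λ,β₀}`-a.e.-measurable, `κ·(c_lo(L)·log β - c_up(L)·log β₀) - C·L^d ≤ κ·d·L^d·log K' + β·Δ_T`;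
* `MeanActionContractionSharp d N G ρ κ` (C2a-C°Δ): the same from the product Haar prior (`β₀ = 0`, no `c_up` term).

READING.  Per unit volume, `log coLip(T) + β·Δ_T/(κ·d·L^d) ≥ (d-1)/(2d)·log β - O(1)`: a flow that contracts
less than the exact law demands produces a model whose mean action exceeds the target's by `≳ κ·d·L^d·log β / β`
— an EXTENSIVE action bias, i.e. (Gibbs variational principle / Pinsker in reverse) a model at KL-distance `≳ L^d`
from `μ_{Λ,β}`, whose Metropolis acceptance or reweighting efficiency is then exponentially small in the volume.
The exact laws are recovered VERBATIM as the case `Δ_T = 0` (`coolingContractionBetween_of_meanAction`,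
`exactTransportContractionSharp_of_meanAction`), so items 57–58 become corollaries of the present file up to the
value of `C`.  PROVED (`meanActionContractionBetween_of_ballVolumes`, `meanActionContractionSharp_of_ballVolumes`)
from two-sided ball volumes and the entropy-growth law, via the tool `klDiv_sub_klDiv_le_of_antilipschitz_meanAction`
(`Scaling/MeanActionTransportSteps.lean`); unconditional instances for `U(1)`, `U(N)`, `SU(N)` in
`Scaling/MeanActionTransportInstances.lean`.  What does NOT survive inexactness is recorded, with the reason, in
`Scaling/BarriersMeanActionTransport.lean` (the heating side and the exponential corners).  Reading: Cover–Thomas,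
*Elements of Information Theory* 2nd ed., Thm 12.1.1; Villani, *Topics in Optimal Transportation* (2003) §9.4.
-/

noncomputable section

namespace Summit.Ventures.LatticeQCDFlow.Theory2.Lattice

open MeasureTheory InformationTheory Metric Set Literature.MathematicalPhysics.QuantumFieldTheory

/-! ## §0. The items -/

section Defs

variable (d N : ℕ) (G : Type) [Group G] [MetricSpace G] [IsTopologicalGroup G] [CompactSpace G]
  [MeasurableSpace G] [BorelSpace G] (ρ : G →* Matrix (Fin N) (Fin N) ℂ) (κ : ℝ)

/-- **(C2a-CΔ) THE MEAN-ACTION CONTRACTION LAW FOR COOLING FLOWS** (OURS, THEORY-2.md §3.3 v2.9): there is `C`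
such that for every `L ≥ 2`, every `1 ≤ β₀ ≤ β` and EVERY `μ_{Λ,β₀}`-a.e.-measurable `K'`-co-Lipschitz map `T` of
`G^E` (sup metric; no push-forward or accuracy condition),
`κ·[((d-1)L^d(1/2-1/L) - 1/2)·log β - ((d-1)L^d+1)/2·log β₀] - C·L^d ≤ κ·d·L^d·log K' + β·(∫ S∘T dμ_{Λ,β₀} - ⟨S⟩_{Λ,β})`
— the exact law `CoolingContractionBetween` with exactness replaced by the mean-action defect of the model.  Proved
for two-sided ball volumes from the entropy-growth law (§1); unconditional for `U(1)`, `U(N)`, `SU(N)`. [folklore] -/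
@[conjecture]
def MeanActionContractionBetween : Prop :=
  ∃ C : ℝ, ∀ (L : ℕ) [NeZero L], 2 ≤ L → ∀ β₀ β : ℝ, 1 ≤ β₀ → β₀ ≤ β →
    ∀ (T : GaugeConfig d L G → GaugeConfig d L G) (K' : NNReal), AntilipschitzWith K' T →
      AEMeasurable T (wilsonMeasure (d := d) (L := L) ρ β₀) →
      κ * ((((d : ℝ) - 1) * (L : ℝ) ^ d * (1 / 2 - 1 / L) - 1 / 2) * Real.log β -
            (((d : ℝ) - 1) * (L : ℝ) ^ d + 1) / 2 * Real.log β₀) - C * (L : ℝ) ^ d ≤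
        κ * ((d : ℝ) * (L : ℝ) ^ d) * Real.log (K' : ℝ) +
          β * (∫ x, wilsonAction (d := d) (L := L) ρ (T x) ∂(wilsonMeasure (d := d) (L := L) ρ β₀) -
            wilsonExpectation (d := d) (L := L) ρ β (wilsonAction (d := d) (L := L) ρ))

/-- **(C2a-C°Δ) THE MEAN-ACTION CONTRACTION LAW FROM THE PRIOR** (OURS, THEORY-2.md §3.3 v2.9): there is `C` such
that for every `L ≥ 2`, every `β ≥ 1` and EVERY `Haar^{⊗E}`-a.e.-measurable `K'`-co-Lipschitz map `T`,
`κ·((d-1)L^d(1/2-1/L) - 1/2)·log β - C·L^d ≤ κ·d·L^d·log K' + β·(∫ S∘T dHaar^{⊗E} - ⟨S⟩_{Λ,β})` — the sharp law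
`ExactTransportContractionSharp` without exactness. [folklore] -/
@[conjecture]
def MeanActionContractionSharp : Prop :=
  ∃ C : ℝ, ∀ (L : ℕ) [NeZero L], 2 ≤ L → ∀ β : ℝ, 1 ≤ β →
    ∀ (T : GaugeConfig d L G → GaugeConfig d L G) (K' : NNReal), AntilipschitzWith K' T →
      AEMeasurable T (Measure.pi fun _ : Edge d L => haarProbability G) →
      κ * (((d : ℝ) - 1) * (L : ℝ) ^ d * (1 / 2 - 1 / L) - 1 / 2) * Real.log β - C * (L : ℝ) ^ d ≤
        κ * ((d : ℝ) * (L : ℝ) ^ d) * Real.log (K' : ℝ) +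
          β * (∫ x, wilsonAction (d := d) (L := L) ρ (T x) ∂(Measure.pi fun _ : Edge d L => haarProbability G) -
            wilsonExpectation (d := d) (L := L) ρ β (wilsonAction (d := d) (L := L) ρ))

end Defs

/-! ## §1. The laws from two-sided ball volumes and the entropy-growth law -/

section Laws

variable {N : ℕ} {G : Type} [Group G] [MetricSpace G] [IsTopologicalGroup G] [CompactSpace G]
  [SecondCountableTopology G] [MeasurableSpace G] [BorelSpace G]
  (ρ : G →* Matrix (Fin N) (Fin N) ℂ)

omit [SecondCountableTopology G] in
/-- A co-Lipschitz constant on `G^E` is positive as soon as `G` has two points (here: from the small-ball upper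
bound with `κ > 0`) and `d ≥ 1`, `L ≥ 1`. [folklore] -/
theorem antilipschitz_pos_of_ballVolumes {d L : ℕ} [NeZero L] (hd : 1 ≤ d) {κ : ℕ} (hκ : 0 < κ) {A : ℝ}
    (hA : 0 < A) (hup : ∀ (g : G) (r : ℝ), 0 < r → (haarProbability G (closedBall g r)).toReal ≤ A * r ^ κ)
    {T : GaugeConfig d L G → GaugeConfig d L G} {K' : NNReal} (hT' : AntilipschitzWith K' T) : 0 < (K' : ℝ) := by
  obtain ⟨g₁, hg₁⟩ := exists_ne_one_of_ballVolumes hκ hA hup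
  set e₀ : Edge d L := (fun _ => 0, ⟨0, hd⟩) with he₀
  have hne : (fun _ : Edge d L => g₁) ≠ (1 : GaugeConfig d L G) := fun h => hg₁ (by
    have := congr_fun h e₀
    simpa using this)
  have h1 := hT'.le_mul_dist (fun _ : Edge d L => g₁) 1
  have hpos : 0 < dist (fun _ : Edge d L => g₁) (1 : GaugeConfig d L G) := dist_pos.2 hne
  rcases K'.coe_nonneg.eq_or_lt with h | h
  · rw [← h, zero_mul] at h1; linarith
  · exact h

/-- **(C2a-CΔ) PROVED from ball volumes + entropy growth** (OURS): two-sided ball volumes with exponent `κ ≥ 1`,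
a continuous `ρ` with `Re tr ρ ≤ N`, `d ≥ 1`, and the two-sided entropy-growth bounds for `(ρ, κ)` ⟹
`MeanActionContractionBetween d N G ρ κ` with `C = 2C_EG + d·(log(A/a) + κ·log 4)`. [folklore] -/
theorem meanActionContractionBetween_of_ballVolumes (d : ℕ) (hd : 1 ≤ d)
    (hρ : Continuous (ρ : G → Matrix (Fin N) (Fin N) ℂ)) (htr : ∀ g, (ρ g).trace.re ≤ N)
    {κ : ℕ} (hκ : 0 < κ) {a A : ℝ} (ha : 0 < a)
    (hlo : ∀ (g : G) (r : ℝ), 0 < r → r ≤ 1 → a * r ^ κ ≤ (haarProbability G (closedBall g r)).toReal)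
    (hup : ∀ (g : G) (r : ℝ), 0 < r → (haarProbability G (closedBall g r)).toReal ≤ A * r ^ κ)
    (hEG : ∃ C : ℝ, ∀ (L : ℕ) [NeZero L], 2 ≤ L → ∀ β : ℝ, 1 ≤ β →
      (κ : ℝ) * (((d : ℝ) - 1) * (L : ℝ) ^ d * (1 / 2 - 1 / L) - 1 / 2) * Real.log β - C * (L : ℝ) ^ d ≤
          (klDiv (wilsonMeasure (d := d) (L := L) ρ β) (Measure.pi fun _ : Edge d L => haarProbability G)).toReal ∧
        (klDiv (wilsonMeasure (d := d) (L := L) ρ β) (Measure.pi fun _ : Edge d L => haarProbability G)).toReal ≤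
          (κ : ℝ) * ((((d : ℝ) - 1) * (L : ℝ) ^ d + 1) / 2) * Real.log β + C * (L : ℝ) ^ d) :
    MeanActionContractionBetween d N G ρ κ := by
  have haA : a ≤ A := by
    have h1 := hlo 1 1 one_pos le_rfl
    have h2 := hup 1 1 one_pos
    rw [one_pow, mul_one] at h1 h2
    exact h1.trans h2
  have hA : 0 < A := ha.trans_le haA
  obtain ⟨C, hC⟩ := hEG
  refine ⟨2 * C + d * (Real.log (A / a) + κ * Real.log 4), fun L _ hL β₀ β hβ₀ hβ₀β T K' hT' hTm => ?_⟩
  have hβ0 : 0 ≤ β := by linarith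
  have hβ₀0 : 0 ≤ β₀ := by linarith
  have hβ1 : 1 ≤ β := hβ₀.trans hβ₀β
  have hK'0 : 0 < (K' : ℝ) := antilipschitz_pos_of_ballVolumes hd hκ hA hup hT'
  have hmain := klDiv_sub_klDiv_le_of_antilipschitz_meanAction ρ hρ htr ha hA hlo hup hβ₀0 hβ0 hK'0 hT' hTm
  have hlo' := (hC L hL β hβ1).1
  have hup' := (hC L hL β₀ hβ₀).2
  have hE : (Fintype.card (Edge d L) : ℝ) = d * (L : ℝ) ^ d := by
    have hEn : Fintype.card (Edge d L) = L ^ d * d := by simp [Fintype.card_prod, ZMod.card, Fintype.card_fin]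
    rw [hEn]; push_cast; ring
  rw [hE] at hmain
  linarith [hmain, hlo', hup']

/-- **(C2a-C°Δ) PROVED from ball volumes + entropy growth** (OURS): as (C2a-CΔ) with `β₀ = 0`, where `μ_{Λ,0}` is
the product Haar prior and `D(π ‖ π) = 0`; only the entropy LOWER bound is used: `C = C_EG + d·(log(A/a) + κ·log 4)`.
[folklore] -/
theorem meanActionContractionSharp_of_ballVolumes (d : ℕ) (hd : 1 ≤ d)
    (hρ : Continuous (ρ : G → Matrix (Fin N) (Fin N) ℂ)) (htr : ∀ g, (ρ g).trace.re ≤ N)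
    {κ : ℕ} (hκ : 0 < κ) {a A : ℝ} (ha : 0 < a)
    (hlo : ∀ (g : G) (r : ℝ), 0 < r → r ≤ 1 → a * r ^ κ ≤ (haarProbability G (closedBall g r)).toReal)
    (hup : ∀ (g : G) (r : ℝ), 0 < r → (haarProbability G (closedBall g r)).toReal ≤ A * r ^ κ)
    (hEG : ∃ C : ℝ, ∀ (L : ℕ) [NeZero L], 2 ≤ L → ∀ β : ℝ, 1 ≤ β →
      (κ : ℝ) * (((d : ℝ) - 1) * (L : ℝ) ^ d * (1 / 2 - 1 / L) - 1 / 2) * Real.log β - C * (L : ℝ) ^ d ≤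
          (klDiv (wilsonMeasure (d := d) (L := L) ρ β) (Measure.pi fun _ : Edge d L => haarProbability G)).toReal) :
    MeanActionContractionSharp d N G ρ κ := by
  have haA : a ≤ A := by
    have h1 := hlo 1 1 one_pos le_rfl
    have h2 := hup 1 1 one_pos
    rw [one_pow, mul_one] at h1 h2
    exact h1.trans h2
  have hA : 0 < A := ha.trans_le haA
  obtain ⟨C, hC⟩ := hEG
  refine ⟨C + d * (Real.log (A / a) + κ * Real.log 4), fun L _ hL β hβ T K' hT' hTm => ?_⟩
  have hβ0 : 0 ≤ β := by linarith
  have hK'0 : 0 < (K' : ℝ) := antilipschitz_pos_of_ballVolumes hd hκ hA hup hT'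
  -- `μ_{Λ,0}` is the product Haar prior (the Wilson weight at `β = 0` is `1`, `Z_Λ(0) = 1`)
  have h00 : wilsonMeasure (d := d) (L := L) ρ 0 = Measure.pi fun _ : Edge d L => haarProbability G := by
    have hW : wilsonWeight (d := d) (L := L) ρ 0 = Measure.pi fun _ : Edge d L => haarProbability G := by
      unfold wilsonWeight
      rw [show (fun U : GaugeConfig d L G => ENNReal.ofReal (Real.exp (-0 * wilsonAction ρ U))) = 1 from
        funext fun U => by simp, withDensity_one]
    unfold wilsonMeasure partitionFunction
    rw [hW, measure_univ, inv_one, one_smul]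
  have hTm' : AEMeasurable T (wilsonMeasure (d := d) (L := L) ρ 0) := by rw [h00]; exact hTm
  have hmain := klDiv_sub_klDiv_le_of_antilipschitz_meanAction ρ hρ htr ha hA hlo hup le_rfl hβ0 hK'0 hT' hTm'
  have h0 : (klDiv (wilsonMeasure (d := d) (L := L) ρ 0) (Measure.pi fun _ : Edge d L => haarProbability G)).toReal
      = 0 := by
    rw [h00, klDiv_self, ENNReal.toReal_zero]
  have hlo' := hC L hL β hβ
  have hE : (Fintype.card (Edge d L) : ℝ) = d * (L : ℝ) ^ d := by
    have hEn : Fintype.card (Edge d L) = L ^ d * d := by simp [Fintype.card_prod, ZMod.card, Fintype.card_fin]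
    rw [hEn]; push_cast; ring
  rw [hE, h0, h00] at hmain
  linarith [hmain, hlo']

/-! ## §2. The exact laws are the case `Δ_T = 0` -/

/-- **(C2a-CΔ) ⟹ (C2a-C′)** (OURS): an exact transport `T_*μ_{Λ,β₀} = μ_{Λ,β}` (`β ≥ 0`) is `μ_{Λ,β₀}`-a.e.-
measurable and has mean-action defect `0`, so `CoolingContractionBetween` is the exact case of
`MeanActionContractionBetween`, with the same constant. [folklore] -/
theorem coolingContractionBetween_of_meanAction {d : ℕ} {κ : ℝ}
    (hρ : Continuous (ρ : G → Matrix (Fin N) (Fin N) ℂ)) (htr : ∀ g, (ρ g).trace.re ≤ N)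
    (h : MeanActionContractionBetween d N G ρ κ) : CoolingContractionBetween d N G ρ κ := by
  obtain ⟨C, hC⟩ := h
  refine ⟨C, fun L _ hL β₀ β hβ₀ hβ₀β T K' hT' hmap => ?_⟩
  have hβ0 : 0 ≤ β := by linarith
  have hTm : AEMeasurable T (wilsonMeasure (d := d) (L := L) ρ β₀) := aemeasurable_of_map_eq_between ρ hρ htr hβ0 hmap
  have h1 := hC L hL β₀ β hβ₀ hβ₀β T K' hT' hTm
  have hE : wilsonExpectation (d := d) (L := L) ρ β (wilsonAction (d := d) (L := L) ρ) =
      ∫ x, wilsonAction (d := d) (L := L) ρ (T x) ∂(wilsonMeasure (d := d) (L := L) ρ β₀) := by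
    unfold wilsonExpectation
    rw [← hmap, integral_map hTm (continuous_wilsonAction (d := d) (L := L) ρ hρ).aestronglyMeasurable]
  rw [hE, sub_self, mul_zero, add_zero] at h1
  exact h1

/-- **(C2a-C°Δ) ⟹ (C2a-C°)** (OURS): likewise from the product Haar prior `= μ_{Λ,0}`. [folklore] -/
theorem exactTransportContractionSharp_of_meanAction {d : ℕ} {κ : ℝ}
    (hρ : Continuous (ρ : G → Matrix (Fin N) (Fin N) ℂ)) (htr : ∀ g, (ρ g).trace.re ≤ N)
    (h : MeanActionContractionSharp d N G ρ κ) : ExactTransportContractionSharp d N G ρ κ := by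
  obtain ⟨C, hC⟩ := h
  refine ⟨C, fun L _ hL β hβ T K' hT' hmap => ?_⟩
  have hβ0 : 0 ≤ β := by linarith
  -- `μ_{Λ,0}` is the product Haar prior (the Wilson weight at `β = 0` is `1`, `Z_Λ(0) = 1`)
  have h00 : wilsonMeasure (d := d) (L := L) ρ 0 = Measure.pi fun _ : Edge d L => haarProbability G := by
    have hW : wilsonWeight (d := d) (L := L) ρ 0 = Measure.pi fun _ : Edge d L => haarProbability G := by
      unfold wilsonWeight
      rw [show (fun U : GaugeConfig d L G => ENNReal.ofReal (Real.exp (-0 * wilsonAction ρ U))) = 1 from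
        funext fun U => by simp, withDensity_one]
    unfold wilsonMeasure partitionFunction
    rw [hW, measure_univ, inv_one, one_smul]
  have hmap' : (wilsonMeasure (d := d) (L := L) ρ 0).map T = wilsonMeasure (d := d) (L := L) ρ β := by
    rw [h00]; exact hmap
  have hTm' := aemeasurable_of_map_eq_between ρ hρ htr hβ0 hmap'
  have hTm : AEMeasurable T (Measure.pi fun _ : Edge d L => haarProbability G) := by rw [← h00]; exact hTm'
  have h1 := hC L hL β hβ T K' hT' hTm
  have hE : wilsonExpectation (d := d) (L := L) ρ β (wilsonAction (d := d) (L := L) ρ) =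
      ∫ x, wilsonAction (d := d) (L := L) ρ (T x) ∂(Measure.pi fun _ : Edge d L => haarProbability G) := by
    unfold wilsonExpectation
    rw [← hmap, integral_map hTm (continuous_wilsonAction (d := d) (L := L) ρ hρ).aestronglyMeasurable]
  rw [hE, sub_self, mul_zero, add_zero] at h1
  exact h1

end Laws

end Summit.Ventures.LatticeQCDFlow.Theory2.Lattice
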